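import Summits.CriticalPhenomena.PercolationContinuityZ3.Theorems.PercNearOneGluingNoHeavyLowerTailSahiCombLeafSound
import Summits.CriticalPhenomena.PercolationContinuityZ3.Theorems.PercNearOneGluingNoHeavyLowerTailSahiSymCubeCombSound
import Summits.CriticalPhenomena.PercolationContinuityZ3.Theorems.PercNearOneGluingNoHeavyLowerTailSahiC4CombCubeFive
import Summits.CriticalPhenomena.PercolationContinuityZ3.Theorems.PercNearOneGluingNoHeavyLowerTailSahiCombRestrict
import Summits.CriticalPhenomena.PercolationContinuityZ3.Theorems.PercNearOneGluingNoHeavyLowerTailSahiSymCubeFiveTen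

/-!
# SAHI'S CONJECTURE HOLDS COEFFICIENTWISE AT EVERY ORDER ON FIVE LETTERS: (M⁺-n) for all `n` on every ground set with `≤ 5` elements

Support file (cell `prim-sahi`, seat `prim-sahi-typer` gen 33; `--supports stmt-CriticalPhenomena-4575`; proposed `--computational`: the closure
of `combPos_sahiE_of_card_le_five_all` is the standard axioms plus EXACTLY 43 `native_decide` axioms, ALL PRE-EXISTING in the tree — the chunk
certificates behind `SahiC3Cube.colourCheck_five` (8) and `checkCube_four` (1), `SahiC4Cube.colourCheck4_five` (8), `SahiSymCube.symCheck_five_five` (4),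
`symCheck_five_six` (7), `symCheckT_five_seven` (5), `symCheckT_five_eight` (4), `symCheckT_five_nine` (4), `symCheckT_five_ten` (2); no evaluation
here, no `sorry`).

THE MATHEMATICS.  Typer gens 27–30 made Sahi's `C_n` a theorem for EVERY `n` and EVERY product measure on `≤ 5` coordinates
(`SahiSymCube.sahiPositive_bernoulliWeight_of_card_le_five_all`) — at the VALUE level: for each `p ∈ [0,1]^5` separately.  Every certificate
behind it is a tensor-Bernstein DIGIT test, i.e. a COMB certificate (`…SahiCombLeafSound`), and both reductions feeding the certificates lift to
the comb level (the saturation / coloured antichains: `…SahiCombSaturation`; the `S_5 × S_n` orbit reduction: `…SahiSymCubeCombSound`; the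
width collapse: an antichain of `2^[5]` has `≤ C(5,2) = 10` members (Sperner), so a colouring using `≥ 11` colours on it does not exist and
`SahiComb.combPos_sahiE_of_surjColouring` closes every order `≥ 11` from the lower ones).  Hence:

* `combPos_fin_five_le_four … combPos_fin_five_le_ten` — (M⁺-k) on `Fin 5` for `k ≤ 10`, order by order from the landed certificates
  (`symCheck_five_five/six`, `symCheckT_five_seven/eight/nine` with `testM`, `symCheckT_five_ten` with `testI`);
* `card_le_ten_of_isAntichain` — Sperner on `2^[5]` in the form needed;
* **`combPos_sahiE_cube_five_all`** — **(M⁺-n) ON `{0,1}^5` FOR EVERY `n`**: for all `n` and all increasing `U_0, …, U_{n−1} ⊆ 2^[5]`,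
  `p ↦ E_n(μ_p; 1_{U_0}, …, 1_{U_{n−1}})` is a nonnegative combination of the degree-`n` tensor-Bernstein basis on `[0,1]^5`;
* **`combPos_sahiE_of_card_le_five_all`** — the same on every ground set with `≤ 5` elements (comb certificates descend to sub-cubes,
  …`SahiCombRestrict`) = `MasterFamilyCombPos n` restricted to `|ι| ≤ 5`, every `n`;
* `sahiE_ind_nonneg_of_card_le_five_all` (value level recovered: gen 30's theorem, now through comb certificates),
  `sahiE_ind_eq_zero_of_interior_zero_of_card_le_five_all` ((M⁺-n) ⇒ (EQ⁰-n): density-free zero sets at every order on five letters).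
HONEST LABEL: computational (43 pre-existing `native_decide` axioms + standard); (M⁺-n) on six or more letters and Sahi's conjecture remain OPEN;
nothing here asserts them. [this work]
-/

namespace Summit.CriticalPhenomena.PercolationContinuityZ3.Theorems

open Finset Function
open Literature.Combinatorics.Sahi2008
open Literature.Probability.Percolation.DecisionTree (ind)
open SahiComb

namespace SahiCombFive

open SahiSymCube SahiInterp
open scoped Classical

/-- (M⁺-k) on `Fin 5` for `1 ≤ k ≤ 4` ((M⁺-1), (M⁺-2): P3; (M⁺-3), (M⁺-4): this generation). [this work] [computational] -/
theorem combPos_fin_five_le_four : ∀ k, 1 ≤ k → k ≤ 4 → ∀ V : Fin k → Set (Set (Fin 5)), (∀ j, IsUpperSet (V j)) →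
    CombPos (fun _ : Fin 5 => k) (fun p => sahiE (bernoulliWeight p) k (fun j => ind (V j))) := by
  intro k hk1 hk4 V hV
  interval_cases k
  · exact masterFamilyCombPos_one (Fin 5) V hV
  · exact masterFamilyCombPos_two (Fin 5) V hV
  · exact SahiC3CombCube.combPos_sahiE_three_family_of_card_le_five (by simp) V hV
  · exact SahiC4Cube.combPos_sahiE_four_cube_five V hV

/-- (M⁺-k) on `Fin 5` for `1 ≤ k ≤ 5` (order 5: `symCheck_five_five`, leaf `testN`). [this work] [computational] -/
theorem combPos_fin_five_le_five : ∀ k, 1 ≤ k → k ≤ 5 → ∀ V : Fin k → Set (Set (Fin 5)), (∀ j, IsUpperSet (V j)) →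
    CombPos (fun _ : Fin 5 => k) (fun p => sahiE (bernoulliWeight p) k (fun j => ind (V j))) := by
  intro k hk1 hk V hV
  rcases Nat.lt_or_ge k 5 with h | h
  · exact combPos_fin_five_le_four k hk1 (by omega) V hV
  · obtain rfl : k = 5 := le_antisymm hk h
    exact combPos_of_symCheck (n := 3) symCheck_five_five (fun A hA => combPos_of_testN A hA) combPos_fin_five_le_four V hV

/-- (M⁺-k) on `Fin 5` for `1 ≤ k ≤ 6` (order 6: `symCheck_five_six`, leaf `testN`). [this work] [computational] -/
theorem combPos_fin_five_le_six : ∀ k, 1 ≤ k → k ≤ 6 → ∀ V : Fin k → Set (Set (Fin 5)), (∀ j, IsUpperSet (V j)) →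
    CombPos (fun _ : Fin 5 => k) (fun p => sahiE (bernoulliWeight p) k (fun j => ind (V j))) := by
  intro k hk1 hk V hV
  rcases Nat.lt_or_ge k 6 with h | h
  · exact combPos_fin_five_le_five k hk1 (by omega) V hV
  · obtain rfl : k = 6 := le_antisymm hk h
    exact combPos_of_symCheck (n := 4) symCheck_five_six (fun A hA => combPos_of_testN A hA) combPos_fin_five_le_five V hV

/-- (M⁺-k) on `Fin 5` for `1 ≤ k ≤ 7` (order 7: `symCheckT_five_seven`, memoised leaf `testM`). [this work] [computational] -/
theorem combPos_fin_five_le_seven : ∀ k, 1 ≤ k → k ≤ 7 → ∀ V : Fin k → Set (Set (Fin 5)), (∀ j, IsUpperSet (V j)) →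
    CombPos (fun _ : Fin 5 => k) (fun p => sahiE (bernoulliWeight p) k (fun j => ind (V j))) := by
  intro k hk1 hk V hV
  rcases Nat.lt_or_ge k 7 with h | h
  · exact combPos_fin_five_le_six k hk1 (by omega) V hV
  · obtain rfl : k = 7 := le_antisymm hk h
    exact combPos_of_symCheckT (n := 5) (fun A hA => combPos_of_testM A hA) symCheckT_five_seven combPos_fin_five_le_six V hV

/-- (M⁺-k) on `Fin 5` for `1 ≤ k ≤ 8` (order 8: `symCheckT_five_eight`). [this work] [computational] -/
theorem combPos_fin_five_le_eight : ∀ k, 1 ≤ k → k ≤ 8 → ∀ V : Fin k → Set (Set (Fin 5)), (∀ j, IsUpperSet (V j)) →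
    CombPos (fun _ : Fin 5 => k) (fun p => sahiE (bernoulliWeight p) k (fun j => ind (V j))) := by
  intro k hk1 hk V hV
  rcases Nat.lt_or_ge k 8 with h | h
  · exact combPos_fin_five_le_seven k hk1 (by omega) V hV
  · obtain rfl : k = 8 := le_antisymm hk h
    exact combPos_of_symCheckT (n := 6) (fun A hA => combPos_of_testM A hA) symCheckT_five_eight combPos_fin_five_le_seven V hV

/-- (M⁺-k) on `Fin 5` for `1 ≤ k ≤ 9` (order 9: `symCheckT_five_nine`). [this work] [computational] -/
theorem combPos_fin_five_le_nine : ∀ k, 1 ≤ k → k ≤ 9 → ∀ V : Fin k → Set (Set (Fin 5)), (∀ j, IsUpperSet (V j)) →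
    CombPos (fun _ : Fin 5 => k) (fun p => sahiE (bernoulliWeight p) k (fun j => ind (V j))) := by
  intro k hk1 hk V hV
  rcases Nat.lt_or_ge k 9 with h | h
  · exact combPos_fin_five_le_eight k hk1 (by omega) V hV
  · obtain rfl : k = 9 := le_antisymm hk h
    exact combPos_of_symCheckT (n := 7) (fun A hA => combPos_of_testM A hA) symCheckT_five_nine combPos_fin_five_le_eight V hV

/-- (M⁺-k) on `Fin 5` for `1 ≤ k ≤ 10` (order 10: `symCheckT_five_ten`, interpolation leaf `testI`). [this work] [computational] -/
theorem combPos_fin_five_le_ten : ∀ k, 1 ≤ k → k ≤ 10 → ∀ V : Fin k → Set (Set (Fin 5)), (∀ j, IsUpperSet (V j)) →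
    CombPos (fun _ : Fin 5 => k) (fun p => sahiE (bernoulliWeight p) k (fun j => ind (V j))) := by
  intro k hk1 hk V hV
  rcases Nat.lt_or_ge k 10 with h | h
  · exact combPos_fin_five_le_nine k hk1 (by omega) V hV
  · obtain rfl : k = 10 := le_antisymm hk h
    exact combPos_of_symCheckT (n := 8) (fun A hA => combPos_of_testI A hA) symCheckT_five_ten combPos_fin_five_le_nine V hV

/-- **Sperner on `2^[5]`**: an antichain of subsets of `Fin 5` has at most `C(5,2) = 10` members (`SahiCubeFive.set_fin_five_width`). [this work] -/
theorem card_le_ten_of_isAntichain (N : Finset (Set (Fin 5))) (hN : IsAntichain (· ≤ ·) (N : Set (Set (Fin 5)))) : N.card ≤ 10 := by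
  by_contra hlt
  push Not at hlt
  have h11 : (Fintype.card (Fin 5)).choose (Fintype.card (Fin 5) / 2) + 1 = 11 := by decide
  let e : {x // x ∈ N} ≃ Fin N.card := N.equivFin
  let y : Fin ((Fintype.card (Fin 5)).choose (Fintype.card (Fin 5) / 2) + 1) → Set (Fin 5) :=
    fun i => (e.symm (Fin.castLE (by omega) (i.cast h11)) : Set (Fin 5))
  obtain ⟨i, j, hij, hle⟩ := SahiCubeFive.set_fin_five_width y
  have hyi : y i ∈ N := (e.symm _).2
  have hyj : y j ∈ N := (e.symm _).2
  have hne : y i ≠ y j := by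
    intro h
    have h1 : e.symm (Fin.castLE (by omega) (i.cast h11)) = e.symm (Fin.castLE (by omega) (j.cast h11)) := Subtype.ext h
    have h2 := Fin.castLE_injective _ (e.symm.injective h1)
    exact hij (Fin.cast_injective h11 h2)
  exact hN hyi hyj hne hle

/-- **(M⁺-n) ON THE FIVE-CUBE FOR EVERY `n`**: for every `n` and all increasing `U_0, …, U_{n−1} ⊆ 2^[5]`, `p ↦ E_n(μ_p; 1_{U_0}, …, 1_{U_{n−1}})`
is a nonnegative combination of the degree-`n` tensor-Bernstein basis on `[0,1]^5` — Sahi's conjecture COEFFICIENTWISE at every order for five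
independent coins.  (Orders `≤ 10` from the certificates; above, a colouring of an antichain of `2^[5]` with all of `≥ 11` colours does not exist.)
[this work] [computational] -/
theorem combPos_sahiE_cube_five_all : ∀ (n : ℕ) (U : Fin n → Set (Set (Fin 5))), (∀ j, IsUpperSet (U j)) →
    CombPos (fun _ : Fin 5 => n) (fun p => sahiE (bernoulliWeight p) n (fun j => ind (U j))) := by
  intro n
  induction n using Nat.strong_induction_on with
  | _ n ih =>
    intro U hU
    rcases Nat.eq_zero_or_pos n with rfl | hpos
    · exact (CombPos.zero _).congr fun _ => sahiE_zero _ _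
    rcases Nat.lt_or_ge n 11 with h10 | h11
    · exact combPos_fin_five_le_ten n hpos (by omega) U hU
    · obtain ⟨k, rfl⟩ : ∃ k, n = k + 2 := ⟨n - 2, by omega⟩
      refine SahiComb.combPos_sahiE_of_surjColouring (fun j _ hj V hV => ih j (by omega) V hV) (fun N c hN hsurj => ?_) U hU
      exfalso
      have hcard := card_le_ten_of_isAntichain N hN
      choose T hT using hsurj
      have hinj : Function.Injective T := by
        intro i j hij
        have hi := (hT i).2
        rw [hij, (hT j).2] at hi
        exact hi.symm
      have hle : k + 2 ≤ N.card := by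
        calc k + 2 = (univ.image T).card := by rw [card_image_of_injective _ hinj, card_univ, Fintype.card_fin]
          _ ≤ N.card := card_le_card fun x hx => by
              obtain ⟨i, -, rfl⟩ := mem_image.1 hx
              exact (hT i).1
      omega

/-- **(M⁺-n) FOR EVERY `n` ON EVERY GROUND SET WITH AT MOST FIVE ELEMENTS** (`MasterFamilyCombPos n` restricted to `|ι| ≤ 5`): comb certificates
descend from the five-cube to its sub-cubes (`SahiCombJunta.combPos_sahiE_of_card_le`). [this work] [computational] -/
theorem combPos_sahiE_of_card_le_five_all {ι : Type} [Fintype ι] (hι : Fintype.card ι ≤ 5) (n : ℕ) (U : Fin n → Set (Set ι))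
    (hU : ∀ j, IsUpperSet (U j)) : CombPos (fun _ : ι => n) (fun p => sahiE (bernoulliWeight p) n (fun j => ind (U j))) :=
  SahiCombJunta.combPos_sahiE_of_card_le hι (fun V hV => combPos_sahiE_cube_five_all n V hV) U hU

/-- Value level recovered (typer gen 30's `sahiE_ind_nonneg_of_isUpperSet_card_le_five`, now through comb certificates): Sahi's `C_n` for every
`n`, every product measure on at most five letters, every family of increasing events. [this work] [computational] -/
theorem sahiE_ind_nonneg_of_card_le_five_all {ι : Type} [Fintype ι] (hι : Fintype.card ι ≤ 5) (n : ℕ) (U : Fin n → Set (Set ι))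
    (hU : ∀ j, IsUpperSet (U j)) (p : ι → unitInterval) : 0 ≤ sahiE (bernoulliWeight p) n (fun j => ind (U j)) :=
  (combPos_sahiE_of_card_le_five_all hι n U hU).nonneg p

/-- **Density-free zero sets at every order on five letters** ((M⁺-n) ⇒ (EQ⁰-n)): a zero of `p ↦ E_n(μ_p; 1_U)` in the OPEN cube `(0,1)^ι`,
`|ι| ≤ 5`, forces `E_n(μ_p; 1_U) = 0` on all of `[0,1]^ι`. [this work] [computational] -/
theorem sahiE_ind_eq_zero_of_interior_zero_of_card_le_five_all {ι : Type} [Fintype ι] (hι : Fintype.card ι ≤ 5) (n : ℕ)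
    {U : Fin n → Set (Set ι)} (hU : ∀ j, IsUpperSet (U j)) {q : ι → unitInterval} (hq : ∀ e, (q e : ℝ) ∈ Set.Ioo (0 : ℝ) 1)
    (h0 : sahiE (bernoulliWeight q) n (fun j => ind (U j)) = 0) (p : ι → unitInterval) :
    sahiE (bernoulliWeight p) n (fun j => ind (U j)) = 0 :=
  (combPos_sahiE_of_card_le_five_all hι n U hU).eq_zero_of_interior hq h0 p

end SahiCombFive

end Summit.CriticalPhenomena.PercolationContinuityZ3.Theorems
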